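import Summits.HodgeConjecture.HodgeConjecture.Theorems.F0P3ClassificationLawsV8
import HarnessLib

/-!
# `F0P3ClassificationEngineV8` (T5-C, edition V8): §1.4 the intermediate statements `PerClassIdentity S₀` ∕ `CoefficientFormula S₀` (14.6.2) and §2 the integrator's own
# mathematics — Z3 `separation_of_laws`, (L1-ii) `hatBounded_cls_of_pins`, `hatInjective_of_pins`, Z2 `perClassIdentity_of_laws` — kit-parametric, PROVED

Theorems rendering (F0P3-plan RULINGS (V9)(b)∕(V12)∕(V41)∕(V43), F0P3-p03) of the T5 statement layer = dossier line
`Cruxes/H413/Lines/F0_T5InnerFormClassification.lean` (v8 rf 3639e4bbb2677e64), split by topic into ★-importable modules (Theorems never import Lines):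
(A) ★ `F0P3ClassificationKitV6` — frame, e.v.p. germs, the kit, pins (§0–§1.2 of the dossier, UNCHANGED at this edition, NOT re-filed; namespace `…V6`);
(B) `F0P3ClassificationLawsV8` — the named laws, their `.mono`, `structure Laws`, over the reducible alias `…V8.ClassificationKit := …V6.ClassificationKit`;
(C) `F0P3ClassificationEngineV8` — §1.4 the intermediate statements (14.6.2) ∕ coefficient formula and §2 the integrator's own mathematics, PROVED;
(R) `F0P3ClassificationReadingV8` — `|E| ≤ 1` glue and the coefficient reading by fibre grouping (v7 §3); (D) `F0P3InnerFormClassificationV8` — the head `shape_of_T5`,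
the kit-family composition `shapeGuarded_of_T5`.  EDITION V8 (namespace suffix `V8`; supersedes the V6 chain ★ p821941∕p822130∕p822263∕p822609 as the edition of record).
Declarations and proofs are BYTE-IDENTICAL to the dossier text (except the type-preserving header spellings marked `dedup.landed` below); only module docstrings, the namespace name, the kit alias + `open`s of the ★ kit edition,
a few one-line docstrings (Theorems lint) and the re-emitted `variable` blocks differ.  No `sorry`, no named fact, no instance, no notation.

THIS MODULE: §1.4 the intermediate statements `PerClassIdentity` ∕ `CoefficientFormula` (+ `.mono`), then §2 of the dossier line (theorems).
HONEST LABEL: HC_CM is proved only modulo the printed citations until rung 0 closes.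
-/

-- (no local instance attribute needed in this module: no `(𝔤,K)`-token binder is spelled here)

set_option autoImplicit false
set_option linter.dupNamespace false

-- Gate lint `dedup.landed` (header-text keyed): theorems whose header text coincides with a landed edition (v3.1 ∕ V5 ∕ V6 ∕ V7-B∕C) are written with
-- ONE binder's dot-notation expanded ∕ a numeral ascribed ∕ `≠` spelled `¬ … = …` — elaborated statements unchanged (F0P3-p03 (g7), 2026-08-31).

noncomputable section

open NumberField IsDedekindDomain MeasureTheory
open scoped Matrix ComplexOrder BigOperators Classical

namespace Summit.HodgeConjecture.HodgeConjecture.Cruxes.H413.F0P3InnerFormClassificationV8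

open Literature.NumberTheory.Rogawski1990 Literature.NumberTheory.GaloisRepresentations
open Literature.NumberTheory.Automorphic Literature.NumberTheory.Automorphic.UnitaryGroup
open Literature.NumberTheory.Automorphic.UnitaryGroup.CotangentForms
open Literature.RepresentationTheory.BorelWallach2000
open Literature.RepresentationTheory.KonnoKonno2007
open Summit.HodgeConjecture.HodgeConjecture.Cruxes.H413.F0P3InnerFormClassificationV6   -- ★ F0P3ClassificationKitV6: §0 frame abbreviations, §1 `Sockets`, the kit structure
open Summit.HodgeConjecture.HodgeConjecture.Cruxes.H413.F0P3InnerFormClassificationV6.ClassificationKit   -- ★ §1.1 derived notation (`coordS`, `Adm`, `memberCoeff`, `expansion`), §1.2 `IsPinned`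

namespace ClassificationKit

variable {L : Type} [Field L] [NumberField L] [IsCMField L] {H : Matrix (Fin 3) (Fin 3) L} {ι : L →+* ℂ} {T : GL (Fin 3) ℂ}
  {hT : (T : Matrix (Fin 3) (Fin 3) ℂ)ᴴ * H.map ι * (T : Matrix (Fin 3) (Fin 3) ℂ) = Literature.Geometry.ComplexHyperbolic.BallModel.J}
  {μ : Measure (Gp L H).automorphicQuotient} [(Gp L H).IsAutomorphicMeasure μ] (𝔠 : ClassificationKit L H ι T hT μ)

/-! ### §1.4 The intermediate statements of pp. 236–239 (the stubs' conclusions; kit-internal, no letter body) -/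

/-- **(14.6.2)** [p. 236 l. 5]: the trace identity REGROUPED per germ `g` of e.v.p.'s off `S` and restricted to classes ∕ packets unramified off `S`. -/
def PerClassIdentity (S₀ : Finset (Places L)) : Prop :=
  ∀ (S : Finset (Places L)) (g : Germ L H S) (fS : 𝔠.TestS S) (fSG : 𝔠.TestSG S) (fSH : 𝔠.TestSH S), S₀ ⊆ S → 𝔠.MatchesS S fS fSG fSH →
    Summable (fun c : {c : 𝔠.Cls // germ L H S (𝔠.evp c) = g ∧ 𝔠.Adm S c} => (𝔠.mult c.1 : ℂ) * 𝔠.chS S (𝔠.coordS S c.1) fS) ∧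
    Summable (fun Q : {Q : 𝔠.PacketG // germ L H S (𝔠.evpG Q) = g ∧ 𝔠.ramG Q ⊆ S} => 𝔠.nG Q.1 * 𝔠.trGS S Q.1 fSG) ∧
    Summable (fun ρ : {ρ : 𝔠.PacketH // germ L H S (𝔠.evpH ρ) = g ∧ 𝔠.ramH ρ ⊆ S} => 𝔠.nH ρ.1 * 𝔠.trHS S ρ.1 fSH) ∧
    (∑' c : {c : 𝔠.Cls // germ L H S (𝔠.evp c) = g ∧ 𝔠.Adm S c}, (𝔠.mult c.1 : ℂ) * 𝔠.chS S (𝔠.coordS S c.1) fS) =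
      (∑' Q : {Q : 𝔠.PacketG // germ L H S (𝔠.evpG Q) = g ∧ 𝔠.ramG Q ⊆ S}, 𝔠.nG Q.1 * 𝔠.trGS S Q.1 fSG) +
        (1 / 2 : ℂ) * ∑' ρ : {ρ : 𝔠.PacketH // germ L H S (𝔠.evpH ρ) = g ∧ 𝔠.ramH ρ ⊆ S}, 𝔠.nH ρ.1 * 𝔠.trHS S ρ.1 fSH

/-- **COEFFICIENT READING** [p. 238 l. −2 – p. 239 l. 4]: in the germ of `t(Π(ξ))` off `S ⊇ ram ξ`, for `Kc`-TRIVIAL classes OF POSITIVE MULTIPLICITY (v7: the grouped reading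
needs no determination law), `m(π′) = E_ξ(π′_ι, (π′_v)_{v ∈ S})`. -/
def CoefficientFormula (S₀ : Finset (Places L)) : Prop :=
  ∀ (ξ : OneDimAutRepH L) (S : Finset (Places L)), S₀ ⊆ S → 𝔠.ram ξ ⊆ S →
    ∀ c : 𝔠.Cls, EqOff L H S (𝔠.evp c) (𝔠.tXi ξ) → 𝔠.Adm S c → 1 ≤ 𝔠.mult c → (𝔠.mult c : ℚ) = 𝔠.expansion ξ S (𝔠.coordS S c)

variable {𝔠} in
/-- The law `PerClassIdentity` is preserved under ENLARGING the level guard `S₀ ⊆ S₀'` (v8, RULING (V44): consumers union the bad sets of their letters). [cite: Rogawski1990, §14.2 p. 228; §14.6 pp. 236–239] -/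
theorem PerClassIdentity.mono {S₀ S₀' : Finset (Places L)} (h : S₀ ⊆ S₀') (hF : 𝔠.PerClassIdentity S₀) : 𝔠.PerClassIdentity S₀' :=
  fun S g fS fSG fSH hS hM => hF S g fS fSG fSH (h.trans hS) hM

variable {𝔠} in
/-- The law `CoefficientFormula` is preserved under ENLARGING the level guard `S₀ ⊆ S₀'` (v8, RULING (V44): consumers union the bad sets of their letters). [cite: Rogawski1990, §14.2 p. 228; §14.6 pp. 236–239] -/
theorem CoefficientFormula.mono {S₀ S₀' : Finset (Places L)} (h : S₀ ⊆ S₀') (hF : 𝔠.CoefficientFormula S₀) : 𝔠.CoefficientFormula S₀' :=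
  fun ξ S hS hr c hc ha hm => hF ξ S (h.trans hS) hr c hc ha hm

end ClassificationKit

/-! ## §2 THE INTEGRATOR'S OWN MATHEMATICS — Z3, Z2, Z10a, all PROVED (kit-parametric; PLAN §24–§25; no `sorry` remains in this file) -/

/-- **Z3 — THE SEPARATION LEMMA from injectivity + unitary bound + `*`-algebra, DISCHARGED IN-HOUSE** [Langlands1980 pp. 208–211 (Stone–Weierstrass on the
compact closure of the bounded parameters; `f = 1` for `Σ|α| < ∞`); Rogawski1990 §13.7 p. 206] := ★ p816508 `separationLemma_of_injective_bounded_starClosed`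
(F0P4-p02 (g5), over ★ p816337 `Literature.Topology.SummableDiracCombSeparation`).  (L1) is OFF the letter ledger. -/
theorem separation_of_laws {L : Type} [Field L] [NumberField L] [IsCMField L] {H : Matrix (Fin 3) (Fin 3) L} {ι : L →+* ℂ} {T : GL (Fin 3) ℂ}
    {hT : (T : Matrix (Fin 3) (Fin 3) ℂ)ᴴ * H.map ι * (T : Matrix (Fin 3) (Fin 3) ℂ) = Literature.Geometry.ComplexHyperbolic.BallModel.J}
    {μ : Measure (Gp L H).automorphicQuotient} [(Gp L H).IsAutomorphicMeasure μ] (𝔠 : ClassificationKit L H ι T hT μ)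
    {S₀ : Finset (Places L)} (hi : 𝔠.HatInjective) (hb : 𝔠.HatBounded S₀) (ha : 𝔠.UnrStarAlgebra S₀) :
    𝔠.Separation S₀ :=
  fun S hS₀ => F0P3SeparationRegroup.separationLemma_of_injective_bounded_starClosed (𝔠.hatAut S) (hi S) (hb S hS₀) (ha S hS₀).1 (ha S hS₀).2.1 (ha S hS₀).2.2

/-- **(L1-ii) FOR THE CLASS SUMMAND, FROM THE PINS — Langlands' unitary bound** [Langlands1980 p. 209; Rogawski1990 §13.7 p. 206]: for every `f^S ∈ Unr S` there is
`C = C(f^S)` with `|f^{S∧}(t(π′))| ≤ C` for EVERY class `π′` unramified off `S`.  Proof: by pin (vii) `f^{S∧}(t) = ∏_{v ∈ T} t_v(f_v)` (`T` finite, off `S`); for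
`v ∈ T` the class `clFin c v` is `K_v`-spherical with eigencharacter `t_v = evp c v` (pin (ii), `v ∉ S ⊇ ramCls c`), admissible (iv) and unitarizable (v), `μv v` is
Haar (iii) so `μ(K_v) ≠ 0`, and ★ p817229 `IsSphericalWith.norm_apply_le_inv_mul_integral_norm` bounds `|t_v(f_v)| ≤ μ(K_v)⁻¹ ∫ |f_v|` independently of the class;
take `C := ∏_{v ∈ T} μ(K_v)⁻¹ ∫ |f_v|`.  (The packet summands `evpG`, `evpH` of `AutGerm` have no local-class anchor in this kit: for them `HatBounded` stays a law.)
[cite: Langlands1980, p. 209] [cite: Rogawski1990, §13.7 p. 206] -/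
theorem hatBounded_cls_of_pins {L : Type} [Field L] [NumberField L] [IsCMField L] {H : Matrix (Fin 3) (Fin 3) L} {ι : L →+* ℂ} {T : GL (Fin 3) ℂ}
    {hT : (T : Matrix (Fin 3) (Fin 3) ℂ)ᴴ * H.map ι * (T : Matrix (Fin 3) (Fin 3) ℂ) = Literature.Geometry.ComplexHyperbolic.BallModel.J}
    {μ : Measure (Gp L H).automorphicQuotient} [(Gp L H).IsAutomorphicMeasure μ] (𝔠 : ClassificationKit L H ι T hT μ)
    (hpin : 𝔠.IsPinned) (S : Finset (Places L)) (fT : 𝔠.Unr S) :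
    ∃ C : ℝ, ∀ c : 𝔠.Cls, 𝔠.ramCls c ⊆ (S : Set (Places L)) → ‖𝔠.hat S (germ L H S (𝔠.evp c)) fT‖ ≤ C := by
  classical
  obtain ⟨-, hsph, hhaar, hadm, hunit, -, hhat, -⟩ := hpin
  obtain ⟨T, hTS, f, hf, hfac⟩ := hhat S fT
  -- the per-place constants `μ(K_v)⁻¹ ∫ ‖f_v‖`
  refine ⟨∏ v ∈ T, (letI : MeasurableSpace ((cmDatum L 3 H).Local v) := borel _
    ((𝔠.μv v).real (cmLocalIntegralLevel L 3 H v : Set ((cmDatum L 3 H).Local v)))⁻¹ * ∫ x, ‖f v x‖ ∂(𝔠.μv v)), fun c hc => ?_⟩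
  rw [hfac (𝔠.evp c)]
  refine (Finset.norm_prod_le _ _).trans (Finset.prod_le_prod (fun v _ => norm_nonneg _) fun v hv => ?_)
  -- at `v ∈ T`: `v ∉ S`, hence `v ∉ ramCls c`, so `clFin c v` is spherical with eigencharacter `evp c v`
  have hvS : v ∉ S := fun h => Finset.disjoint_left.1 hTS hv h
  have hvr : v ∉ 𝔠.ramCls c := fun h => hvS (Finset.mem_coe.1 (hc h))
  letI : MeasurableSpace ((cmDatum L 3 H).Local v) := borel _
  haveI : BorelSpace ((cmDatum L 3 H).Local v) := ⟨rfl⟩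
  haveI : (𝔠.μv v).IsHaarMeasure := hhaar v
  obtain ⟨hKc, hKo⟩ := UnitaryGroup.isCompact_isOpen_cmLocalIntegralLevel L 3 H v
  have hμK : (𝔠.μv v).real (cmLocalIntegralLevel L 3 H v : Set ((cmDatum L 3 H).Local v)) ≠ 0 := by
    rw [measureReal_def, ENNReal.toReal_ne_zero]
    exact ⟨(hKo.measure_pos (𝔠.μv v) ⟨1, (cmLocalIntegralLevel L 3 H v).one_mem⟩).ne', hKc.measure_lt_top.ne⟩
  exact (hsph c v hvr).norm_apply_le_inv_mul_integral_norm (𝔠.μv v) (hadm c v hvr) (hunit c v hvr) hKo hKc hμK (hf v hv).1 (hf v hv).2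

/-- **(L1-i) `HatInjective` FROM THE PINS — «`t ↦ f ↦ f^{S∧}(t)` is injective on germs of automorphic origin»** [Rogawski1990 §13.7 p. 206; CartierCorvallis1979
§IV.1]: with ONE junk convention for every e.v.p. field (pin (vi) for `evp`, law `EvpConvention` for `evpG`∕`evpH`) and the richness pin (viii) (single-place families),
two automorphic germs with the same `hat` agree at every `v ∉ S` on `C_c(K_v\G′_v/K_v)` (evaluate `hat` on the family carrying `f` at `v` alone), hence as functionals,
hence as germs.  No Satake isomorphism and no rigidity is used: (L1-i) is OFF the letter ledger given the pins. [cite: Rogawski1990, §13.7 p. 206] [cite: CartierCorvallis1979, §IV.1] -/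
theorem hatInjective_of_pins {L : Type} [Field L] [NumberField L] [IsCMField L] {H : Matrix (Fin 3) (Fin 3) L} {ι : L →+* ℂ} {T : GL (Fin 3) ℂ}
    {hT : (T : Matrix (Fin 3) (Fin 3) ℂ)ᴴ * H.map ι * (T : Matrix (Fin 3) (Fin 3) ℂ) = Literature.Geometry.ComplexHyperbolic.BallModel.J}
    {μ : Measure (Gp L H).automorphicQuotient} [(Gp L H).IsAutomorphicMeasure μ] (𝔠 : ClassificationKit L H ι T hT μ)
    (hpin : ClassificationKit.IsPinned 𝔠) (hconv : ClassificationKit.EvpConvention 𝔠) : 𝔠.HatInjective := by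
  classical
  obtain ⟨-, -, -, -, -, hjunk, -, hrich, -⟩ := hpin
  intro S g₁ g₂ h
  obtain ⟨t₁, ht₁, ho₁⟩ := g₁.2
  obtain ⟨t₂, ht₂, ho₂⟩ := g₂.2
  -- junk off the spherical Hecke algebra, for every automorphic origin
  have junk : ∀ t : EvpData L H,
      ((∃ c, 𝔠.Adm S c ∧ 𝔠.evp c = t) ∨ (∃ Q, 𝔠.ramG Q ⊆ S ∧ 𝔠.evpG Q = t) ∨ (∃ ρ, 𝔠.ramH ρ ⊆ S ∧ 𝔠.evpH ρ = t)) →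
      ∀ (v : Places L) (f : (cmDatum L 3 H).Local v → ℂ), ¬ (HasCompactSupport f ∧ IsLevel (cmLocalIntegralLevel L 3 H v) f) → t v f = 0 := by
    rintro t (⟨c, -, rfl⟩ | ⟨Q, -, rfl⟩ | ⟨ρ, -, rfl⟩) v f hf
    · exact hjunk c v f hf
    · exact hconv.1 Q v f hf
    · exact hconv.2.1 ρ v f hf
  apply Subtype.ext
  rw [← ht₁, ← ht₂, germ_eq_germ_iff]
  intro v hv
  funext f
  by_cases hf : HasCompactSupport f ∧ IsLevel (cmLocalIntegralLevel L 3 H v) f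
  · -- the single-place family carrying `f` at `v`
    have hTS : Disjoint ({v} : Finset (Places L)) S := Finset.disjoint_singleton_left.2 hv
    obtain ⟨fT, hfT⟩ := hrich S {v} hTS (Function.update (fun w => (0 : (cmDatum L 3 H).Local w → ℂ)) v f)
      (fun w hw => by
        rw [Finset.mem_singleton] at hw
        subst hw
        rw [Function.update_self]
        exact hf)
    have e : 𝔠.hat S g₁.1 fT = 𝔠.hat S g₂.1 fT := congrFun h fT
    rw [← ht₁, ← ht₂, hfT t₁, hfT t₂, Finset.prod_singleton, Finset.prod_singleton, Function.update_self] at e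
    exact e
  · rw [junk t₁ ho₁ v f hf, junk t₂ ho₂ v f hf]

/-- **Z2 — SEPARATING BY HECKE EIGENVALUES, PROVED (F0P3-p03 (g6) paste-closer f0193005b3c8331e, folded)** [Rogawski1990 p. 236 l. 3; §13.7 p. 206]: from (14.6.1) (`TraceIdentity`), the spectral side of `G′`,
the unramified factorisations, matching of factorised triples and the separation lemma, the identity holds GERM BY GERM: (14.6.2).  Size M (absolute
convergence bookkeeping; ★ p816018 `F0P3SeparationRegroup.regroup_by_evp` is its abstract core). -/
theorem perClassIdentity_of_laws {L : Type} [Field L] [NumberField L] [IsCMField L] {H : Matrix (Fin 3) (Fin 3) L} {ι : L →+* ℂ} {T : GL (Fin 3) ℂ}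
    {hT : (T : Matrix (Fin 3) (Fin 3) ℂ)ᴴ * H.map ι * (T : Matrix (Fin 3) (Fin 3) ℂ) = Literature.Geometry.ComplexHyperbolic.BallModel.J}
    {μ : Measure (Gp L H).automorphicQuotient} [(Gp L H).IsAutomorphicMeasure μ] (𝔠 : ClassificationKit L H ι T hT μ)
    {S₀ : Finset (Places L)}
    (h1 : 𝔠.TraceIdentity) (h2 : 𝔠.SpectralSideGp) (h3 : 𝔠.Factorisation S₀) (h4 : 𝔠.MatchingS S₀) (h5 : 𝔠.Separation S₀)
    (ha : 𝔠.UnrStarAlgebra S₀) :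
    𝔠.PerClassIdentity S₀ := by
  intro S g fS fSG fSH hS₀ hM
  classical
  -- the unit of the unramified Hecke algebra (L1-iii) and the matched, smooth triples `(tens fS fT, tensG fSG fT, tensH fSH fT)`
  obtain ⟨u, hu⟩ := (ha S hS₀).2.2
  -- index maps into the germs OF AUTOMORPHIC ORIGIN
  let ec : {c : 𝔠.Cls // 𝔠.Adm S c} → 𝔠.AutGerm S :=
    fun c => ⟨germ L H S (𝔠.evp c.1), 𝔠.evp c.1, rfl, Or.inl ⟨c.1, c.2, rfl⟩⟩
  let eQ : {Q : 𝔠.PacketG // 𝔠.ramG Q ⊆ S} → 𝔠.AutGerm S :=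
    fun Q => ⟨germ L H S (𝔠.evpG Q.1), 𝔠.evpG Q.1, rfl, Or.inr (Or.inl ⟨Q.1, Q.2, rfl⟩)⟩
  let eρ : {ρ : 𝔠.PacketH // 𝔠.ramH ρ ⊆ S} → 𝔠.AutGerm S :=
    fun ρ => ⟨germ L H S (𝔠.evpH ρ.1), 𝔠.evpH ρ.1, rfl, Or.inr (Or.inr ⟨ρ.1, ρ.2, rfl⟩)⟩
  -- (1) the three families, factorised, as `HasSum`s over the unramified indices
  have Hc : ∀ fT : 𝔠.Unr S, HasSum (fun c : {c : 𝔠.Cls // 𝔠.Adm S c} =>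
      (𝔠.mult c.1 : ℂ) * 𝔠.chS S (𝔠.coordS S c.1) fS * 𝔠.hatAut S (ec c) fT) (𝔠.traceGp (𝔠.tens S fS fT)) := by
    intro fT
    obtain ⟨hs, hid⟩ := h2 S fS fT
    have hoff : ∀ c : 𝔠.Cls, c ∉ Set.range (Subtype.val : {c : 𝔠.Cls // 𝔠.Adm S c} → 𝔠.Cls) →
        (𝔠.mult c : ℂ) * 𝔠.trGp c (𝔠.tens S fS fT) = 0 := by
      intro c hc
      have hc' : ¬ 𝔠.Adm S c := fun h => hc ⟨⟨c, h⟩, rfl⟩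
      rw [((h3.1 S c fS fT hS₀).2 hc'), mul_zero]
    have h := (Subtype.val_injective.hasSum_iff hoff).2 (hid ▸ hs.hasSum)
    refine h.congr_fun fun c => ?_
    simp only [Function.comp_apply]
    rw [(h3.1 S c.1 fS fT hS₀).1 c.2, mul_assoc]
    rfl
  have HQ : ∀ fT : 𝔠.Unr S, HasSum (fun Q : {Q : 𝔠.PacketG // 𝔠.ramG Q ⊆ S} =>
      𝔠.nG Q.1 * 𝔠.trGS S Q.1 fSG * 𝔠.hatAut S (eQ Q) fT) (∑' Q : 𝔠.PacketG, 𝔠.nG Q * 𝔠.trG Q (𝔠.tensG S fSG fT)) := by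
    intro fT
    obtain ⟨hsm, hmt⟩ := h4 S fS fSG fSH fT hS₀ hM
    obtain ⟨hs, -, -⟩ := h1 _ _ _ hsm hmt
    have hoff : ∀ Q : 𝔠.PacketG, Q ∉ Set.range (Subtype.val : {Q : 𝔠.PacketG // 𝔠.ramG Q ⊆ S} → 𝔠.PacketG) →
        𝔠.nG Q * 𝔠.trG Q (𝔠.tensG S fSG fT) = 0 := by
      intro Q hQ
      have hQ' : ¬ 𝔠.ramG Q ⊆ S := fun h => hQ ⟨⟨Q, h⟩, rfl⟩
      rw [((h3.2.1 S Q fSG fT hS₀).2 hQ'), mul_zero]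
    have h := (Subtype.val_injective.hasSum_iff hoff).2 hs.hasSum
    refine h.congr_fun fun Q => ?_
    simp only [Function.comp_apply]
    rw [(h3.2.1 S Q.1 fSG fT hS₀).1 Q.2, mul_assoc]
    rfl
  have Hρ : ∀ fT : 𝔠.Unr S, HasSum (fun ρ : {ρ : 𝔠.PacketH // 𝔠.ramH ρ ⊆ S} =>
      𝔠.nH ρ.1 * 𝔠.trHS S ρ.1 fSH * 𝔠.hatAut S (eρ ρ) fT) (∑' ρ : 𝔠.PacketH, 𝔠.nH ρ * 𝔠.trH ρ (𝔠.tensH S fSH fT)) := by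
    intro fT
    obtain ⟨hsm, hmt⟩ := h4 S fS fSG fSH fT hS₀ hM
    obtain ⟨-, hs, -⟩ := h1 _ _ _ hsm hmt
    have hoff : ∀ ρ : 𝔠.PacketH, ρ ∉ Set.range (Subtype.val : {ρ : 𝔠.PacketH // 𝔠.ramH ρ ⊆ S} → 𝔠.PacketH) →
        𝔠.nH ρ * 𝔠.trH ρ (𝔠.tensH S fSH fT) = 0 := by
      intro ρ hρ
      have hρ' : ¬ 𝔠.ramH ρ ⊆ S := fun h => hρ ⟨⟨ρ, h⟩, rfl⟩
      rw [((h3.2.2 S ρ fSH fT hS₀).2 hρ'), mul_zero]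
    have h := (Subtype.val_injective.hasSum_iff hoff).2 hs.hasSum
    refine h.congr_fun fun ρ => ?_
    simp only [Function.comp_apply]
    rw [(h3.2.2 S ρ.1 fSH fT hS₀).1 ρ.2, mul_assoc]
    rfl
  -- (2) fibre summability from the unit `u` (`hat g u = 1` for germs of automorphic origin)
  have Fc : ∀ t : 𝔠.AutGerm S, Summable (fun c : {c : {c : 𝔠.Cls // 𝔠.Adm S c} // ec c = t} =>
      (𝔠.mult c.1.1 : ℂ) * 𝔠.chS S (𝔠.coordS S c.1.1) fS) := by
    intro t
    have h := ((Hc u).summable).subtype (fun c => ec c = t)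
    refine h.congr fun c => ?_
    simp only [Function.comp_apply, hu, mul_one]
  have FQ : ∀ t : 𝔠.AutGerm S, Summable (fun Q : {Q : {Q : 𝔠.PacketG // 𝔠.ramG Q ⊆ S} // eQ Q = t} =>
      𝔠.nG Q.1.1 * 𝔠.trGS S Q.1.1 fSG) := by
    intro t
    have h := ((HQ u).summable).subtype (fun Q => eQ Q = t)
    refine h.congr fun Q => ?_
    simp only [Function.comp_apply, hu, mul_one]
  have Fρ : ∀ t : 𝔠.AutGerm S, Summable (fun ρ : {ρ : {ρ : 𝔠.PacketH // 𝔠.ramH ρ ⊆ S} // eρ ρ = t} =>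
      𝔠.nH ρ.1.1 * 𝔠.trHS S ρ.1.1 fSH) := by
    intro t
    have h := ((Hρ u).summable).subtype (fun ρ => eρ ρ = t)
    refine h.congr fun ρ => ?_
    simp only [Function.comp_apply, hu, mul_one]
  -- (3) regrouping by germs (★ B1) and the separation lemma: every germ's combination vanishes
  have hα : ∀ t : 𝔠.AutGerm S,
      (∑' c : {c : {c : 𝔠.Cls // 𝔠.Adm S c} // ec c = t}, (𝔠.mult c.1.1 : ℂ) * 𝔠.chS S (𝔠.coordS S c.1.1) fS) -
        ((∑' Q : {Q : {Q : 𝔠.PacketG // 𝔠.ramG Q ⊆ S} // eQ Q = t}, 𝔠.nG Q.1.1 * 𝔠.trGS S Q.1.1 fSG) +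
          (1 / 2 : ℂ) * ∑' ρ : {ρ : {ρ : 𝔠.PacketH // 𝔠.ramH ρ ⊆ S} // eρ ρ = t}, 𝔠.nH ρ.1.1 * 𝔠.trHS S ρ.1.1 fSH) = 0 := by
    have key : ∀ fT : 𝔠.Unr S, HasSum (fun t : 𝔠.AutGerm S =>
        ((∑' c : {c : {c : 𝔠.Cls // 𝔠.Adm S c} // ec c = t}, (𝔠.mult c.1.1 : ℂ) * 𝔠.chS S (𝔠.coordS S c.1.1) fS) -
          ((∑' Q : {Q : {Q : 𝔠.PacketG // 𝔠.ramG Q ⊆ S} // eQ Q = t}, 𝔠.nG Q.1.1 * 𝔠.trGS S Q.1.1 fSG) +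
            (1 / 2 : ℂ) * ∑' ρ : {ρ : {ρ : 𝔠.PacketH // 𝔠.ramH ρ ⊆ S} // eρ ρ = t}, 𝔠.nH ρ.1.1 * 𝔠.trHS S ρ.1.1 fSH)) *
          𝔠.hatAut S t fT) 0 := by
      intro fT
      have hc := F0P3SeparationRegroup.hasSum_regroup_by_evp ec (𝔠.hatAut S) (fun c => (𝔠.mult c.1 : ℂ))
        (fun c fS => 𝔠.chS S (𝔠.coordS S c.1) fS) fS fT (Hc fT) Fc
      have hQ := F0P3SeparationRegroup.hasSum_regroup_by_evp eQ (𝔠.hatAut S) (fun Q => 𝔠.nG Q.1)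
        (fun Q fSG => 𝔠.trGS S Q.1 fSG) fSG fT (HQ fT) FQ
      have hρ := F0P3SeparationRegroup.hasSum_regroup_by_evp eρ (𝔠.hatAut S) (fun ρ => 𝔠.nH ρ.1)
        (fun ρ fSH => 𝔠.trHS S ρ.1 fSH) fSH fT (Hρ fT) Fρ
      obtain ⟨hsm, hmt⟩ := h4 S fS fSG fSH fT hS₀ hM
      obtain ⟨-, -, hid⟩ := h1 _ _ _ hsm hmt
      have htot := hc.sub (hQ.add (hρ.mul_left (1 / 2 : ℂ)))
      rw [hid, sub_self] at htot
      refine htot.congr_fun fun t => ?_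
      ring
    exact h5 S hS₀ _ (fun fT => (key fT).summable) (fun fT => (key fT).tsum_eq)
  -- (4) read off at the germ `g`: either `g` is of automorphic origin, or all three fibres are empty
  by_cases hg : ∃ t, germ L H S t = g ∧
      ((∃ c, 𝔠.Adm S c ∧ 𝔠.evp c = t) ∨ (∃ Q, 𝔠.ramG Q ⊆ S ∧ 𝔠.evpG Q = t) ∨ (∃ ρ, 𝔠.ramH ρ ⊆ S ∧ 𝔠.evpH ρ = t))
  · -- the three fibre equivalences with the goal's index types
    let Ec : {c : {c : 𝔠.Cls // 𝔠.Adm S c} // ec c = ⟨g, hg⟩} ≃ {c : 𝔠.Cls // germ L H S (𝔠.evp c) = g ∧ 𝔠.Adm S c} :=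
      { toFun := fun c => ⟨c.1.1, congrArg Subtype.val c.2, c.1.2⟩
        invFun := fun c => ⟨⟨c.1, c.2.2⟩, Subtype.ext c.2.1⟩
        left_inv := fun c => rfl
        right_inv := fun c => rfl }
    let EQ : {Q : {Q : 𝔠.PacketG // 𝔠.ramG Q ⊆ S} // eQ Q = ⟨g, hg⟩} ≃ {Q : 𝔠.PacketG // germ L H S (𝔠.evpG Q) = g ∧ 𝔠.ramG Q ⊆ S} :=
      { toFun := fun Q => ⟨Q.1.1, congrArg Subtype.val Q.2, Q.1.2⟩
        invFun := fun Q => ⟨⟨Q.1, Q.2.2⟩, Subtype.ext Q.2.1⟩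
        left_inv := fun Q => rfl
        right_inv := fun Q => rfl }
    let Eρ : {ρ : {ρ : 𝔠.PacketH // 𝔠.ramH ρ ⊆ S} // eρ ρ = ⟨g, hg⟩} ≃ {ρ : 𝔠.PacketH // germ L H S (𝔠.evpH ρ) = g ∧ 𝔠.ramH ρ ⊆ S} :=
      { toFun := fun ρ => ⟨ρ.1.1, congrArg Subtype.val ρ.2, ρ.1.2⟩
        invFun := fun ρ => ⟨⟨ρ.1, ρ.2.2⟩, Subtype.ext ρ.2.1⟩
        left_inv := fun ρ => rfl
        right_inv := fun ρ => rfl }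
    have sc := (Ec.summable_iff (f := fun c : {c : 𝔠.Cls // germ L H S (𝔠.evp c) = g ∧ 𝔠.Adm S c} =>
      (𝔠.mult c.1 : ℂ) * 𝔠.chS S (𝔠.coordS S c.1) fS)).1 (Fc ⟨g, hg⟩)
    have sQ := (EQ.summable_iff (f := fun Q : {Q : 𝔠.PacketG // germ L H S (𝔠.evpG Q) = g ∧ 𝔠.ramG Q ⊆ S} =>
      𝔠.nG Q.1 * 𝔠.trGS S Q.1 fSG)).1 (FQ ⟨g, hg⟩)
    have sρ := (Eρ.summable_iff (f := fun ρ : {ρ : 𝔠.PacketH // germ L H S (𝔠.evpH ρ) = g ∧ 𝔠.ramH ρ ⊆ S} =>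
      𝔠.nH ρ.1 * 𝔠.trHS S ρ.1 fSH)).1 (Fρ ⟨g, hg⟩)
    refine ⟨sc, sQ, sρ, ?_⟩
    have h := hα ⟨g, hg⟩
    rw [← Ec.tsum_eq (fun c : {c : 𝔠.Cls // germ L H S (𝔠.evp c) = g ∧ 𝔠.Adm S c} =>
        (𝔠.mult c.1 : ℂ) * 𝔠.chS S (𝔠.coordS S c.1) fS),
      ← EQ.tsum_eq (fun Q : {Q : 𝔠.PacketG // germ L H S (𝔠.evpG Q) = g ∧ 𝔠.ramG Q ⊆ S} => 𝔠.nG Q.1 * 𝔠.trGS S Q.1 fSG),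
      ← Eρ.tsum_eq (fun ρ : {ρ : 𝔠.PacketH // germ L H S (𝔠.evpH ρ) = g ∧ 𝔠.ramH ρ ⊆ S} => 𝔠.nH ρ.1 * 𝔠.trHS S ρ.1 fSH)]
    exact sub_eq_zero.1 h
  · -- no class or packet has germ `g`: all three fibres are empty
    have e1 : IsEmpty {c : 𝔠.Cls // germ L H S (𝔠.evp c) = g ∧ 𝔠.Adm S c} :=
      ⟨fun c => hg ⟨𝔠.evp c.1, c.2.1, Or.inl ⟨c.1, c.2.2, rfl⟩⟩⟩
    have e2 : IsEmpty {Q : 𝔠.PacketG // germ L H S (𝔠.evpG Q) = g ∧ 𝔠.ramG Q ⊆ S} :=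
      ⟨fun Q => hg ⟨𝔠.evpG Q.1, Q.2.1, Or.inr (Or.inl ⟨Q.1, Q.2.2, rfl⟩)⟩⟩
    have e3 : IsEmpty {ρ : 𝔠.PacketH // germ L H S (𝔠.evpH ρ) = g ∧ 𝔠.ramH ρ ⊆ S} :=
      ⟨fun ρ => hg ⟨𝔠.evpH ρ.1, ρ.2.1, Or.inr (Or.inr ⟨ρ.1, ρ.2.2, rfl⟩)⟩⟩
    refine ⟨summable_empty, summable_empty, summable_empty, ?_⟩
    rw [tsum_empty, tsum_empty, tsum_empty]
    ring

end Summit.HodgeConjecture.HodgeConjecture.Cruxes.H413.F0P3InnerFormClassificationV8
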